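import Literature.MathematicalPhysics.KineticTheory.LangevinChainH2
import Literature.MathematicalPhysics.KineticTheory.LangevinChainCentreOfMass
import HarnessLib

/-!
# CEHR Theorem 5.1 / Remark 5.2 for the pinned chain: the discharge of `CuneoEckmannHairerReyBellet2018_H2`

Trunk T-KINETIC (Literature/MathematicalPhysics/KineticTheory). The provefact unit of the named fact
`CuneoEckmannHairerReyBellet2018_H2` (`LangevinChainDynkin.lean`): Cuneo–Eckmann–Hairer–Rey-Bellet,
*Non-equilibrium steady states for networks of oscillators*, EJP 23 (2018) no. 55, Theorem 5.1 with
Remark 5.2 (the Lyapunov condition H2 for `V = e^{θH}`, arXiv pp. 11–12), for the transition kernels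
of the pinned chain constructed in the tree, in the full parameter range of the fact (`ω₂, β, γ > 0`,
`lam ≥ 0`, `N ≥ 1`, `T_L, T_R > 0`, `0 < θ < 1/max(T_L, T_R)`, every `t* > 0`).

This file assembles the sorry-free, Itô-free route developed in
`LangevinChainH2.lean` (the probabilistic shell: Remark 5.2 from a uniform decay, one window by
Chapman–Kolmogorov and (3.4), the window estimate from a pathwise energy drop by Hölder and (3.4)),
`LangevinChainEnergyScale.lean` (energy at scale `K⁴`, the pathwise energy inequality with the
dissipation), `LangevinChainLimitFlow.lean` and `LangevinChainScaleCloseness.lean` (CEHR §5.1: the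
limit system, Prop. 5.14, and the dissipation bound `≥ εK³` over the window `1/K` in the
interaction regime), `LangevinChainCentreOfMass.lean` (CEHR §5.2: the dissipation bound `≥ εK⁴` over
a window of order one in the pinning regime, `lam = 0`):

* `limitChain_hamiltonian_ge_half_of_pos` — for quartic pinning `lam > 0` (`ℓ_i = ℓ_p = 4`) every
  high-energy point is in the interaction regime (the rescaled harmonic energy is `O(K⁻²)`).
* `wienerPair_compl_goodEvent_le`, `norm_chainNoise_le_of_mem_goodEvent` — the bad event
  `{sup_{[0,w]}|B| > √K/c}` has probability `O(1/K)` (`BrownianSupTail.lean`), and on the good event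
  the noise path has size `≤ √K`.
* `pinnedChain_window_decay_of_dissipation` — one window: a pathwise dissipation bound beating the
  energy error, plus the small bad event, give `P_w e^{θH}(z) ≤ κ₀ e^{θH(z)}`.
* `CuneoEckmannHairerReyBellet2018_H2_holds` — **the discharge**: the scale `K = H(z)^{1/4}`, the
  regime dichotomy `Ĥ(rescale K z) ≥ 1/2` / `< 1/2` (the latter only for `lam = 0`), and the two
  dissipation packages, fed into the shell of `LangevinChainH2.lean`.

## References

* N. Cuneo, J.-P. Eckmann, M. Hairer, L. Rey-Bellet, EJP 23 (2018) no. 55 (arXiv:1712.09413),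
  Thm 5.1, Rem 5.2, Prop. 5.3, §5.1–5.2, Rem 5.7; §3 eq. (3.4).
* P. Carmona, Stoch. Proc. Appl. 117 (2007) 1076–1092 (the decay `E e^{θH(z_{t*})-θH(z₀)} → 0`).
-/

noncomputable section

open MeasureTheory ProbabilityTheory Filter Topology Set Metric Function
open scoped NNReal ENNReal

namespace Literature.MathematicalPhysics.KineticTheory.HeatConduction

open Literature.Probability.Process OscillatorChain Literature.Analysis.ODE

variable {N : ℕ}

/-! ### For `lam > 0` the interaction regime is automatic at high energy -/

/-- `t² ≤ A` forces `t ≤ max 1 A` for `t ≥ 0`. [folklore] -/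
theorem le_max_one_of_sq_le {t A : ℝ} (ht : 0 ≤ t) (h : t ^ 2 ≤ A) : t ≤ max 1 A := by
  rcases le_or_gt t 1 with h1 | h1
  · exact h1.trans (le_max_left _ _)
  · refine le_max_of_le_right ?_
    calc t ≤ t ^ 2 := by nlinarith
      _ ≤ A := h

/-- **For quartic pinning (`lam > 0`) every high-energy point is in the interaction regime**:
if `K⁴ ≤ H(x) ≤ 2K⁴` and `K² ≥ 2C_Φ` (`C_Φ = N(ω₂ max(1, 8/lam) + max(1, 8/β))/2`), then
`Ĥ(rescale K x) ≥ 1/2` — the rescaled harmonic energy `K⁻²Φ₂` is `O(K⁻²)` on the compact shell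
(CEHR §5.1, `ℓ_i = ℓ_p`: "such a distinction is not necessary").
[cite: CuneoEckmannHairerReyBellet2018, §5.1 Lemma 5.13 and eq. (5.13)] -/
theorem limitChain_hamiltonian_ge_half_of_pos {ω₂ lam β γ : ℝ} (hω : 0 < ω₂) (hl : 0 < lam) (hβ : 0 < β)
    {K : ℝ} (hK : 1 ≤ K)
    (hKΦ : 2 * (N * (ω₂ * max 1 (8 / lam) + max 1 (8 / β)) / 2) ≤ K ^ 2)
    {x : PhaseSpace N} (hx1 : K ^ 4 ≤ (pinnedChain ω₂ lam β γ).hamiltonian N x)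
    (hx2 : (pinnedChain ω₂ lam β γ).hamiltonian N x ≤ 2 * K ^ 4) :
    1 / 2 ≤ (limitChain lam β).hamiltonian N (rescale K x) := by
  have hK0 : 0 < K := by linarith
  have hscale := pinnedChain_hamiltonian_eq_scaled ω₂ lam β γ hK0.ne' N x
  have hdiff := scaledChain_hamiltonian_sub_limit ω₂ lam β (K ^ 2)⁻¹ N (rescale K x)
  -- `H̃ ≥ 1`
  have hHs : 1 ≤ (scaledChain ω₂ lam β (K ^ 2)⁻¹).hamiltonian N (rescale K x) := by
    have hK4 : 0 < K ^ 4 := by positivity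
    refine le_of_mul_le_mul_left ?_ hK4
    rw [mul_one, ← hscale]; exact hx1
  -- the harmonic part `Φ₂(x̃) ≤ C_Φ`
  have hq : ∀ i, ω₂ * (rescale K x).1 i ^ 2 / 2 ≤ ω₂ * max 1 (8 / lam) / 2 := by
    intro i
    have hU := pinnedChain_U_le_hamiltonian hω.le hl.le hβ.le γ N x i
    have h4 : ((rescale K x).1 i ^ 2) ^ 2 ≤ 8 / lam := by
      rw [rescale_fst, ← pow_mul, show 2 * 2 = 4 by norm_num, mul_pow, inv_pow, le_div_iff₀ hl]
      have : lam * x.1 i ^ 4 ≤ 8 * K ^ 4 := by nlinarith [mul_nonneg hω.le (sq_nonneg (x.1 i))]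
      calc (K ^ 4)⁻¹ * x.1 i ^ 4 * lam = lam * x.1 i ^ 4 / K ^ 4 := by ring
        _ ≤ 8 * K ^ 4 / K ^ 4 := div_le_div_of_nonneg_right this (by positivity)
        _ = 8 := by field_simp
    have := le_max_one_of_sq_le (sq_nonneg _) h4
    nlinarith [hω.le]
  have hb : ∀ i j : Fin N, j.val = i.val + 1 →
      ((rescale K x).1 j - (rescale K x).1 i) ^ 2 / 2 ≤ max 1 (8 / β) / 2 := by
    intro i j hj
    have hbd := pinnedChain_bond_le_hamiltonian hω.le hl.le hβ.le γ N x hj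
    have h4 : (((rescale K x).1 j - (rescale K x).1 i) ^ 2) ^ 2 ≤ 8 / β := by
      rw [rescale_fst, rescale_fst, ← mul_sub, ← pow_mul, show 2 * 2 = 4 by norm_num, mul_pow, inv_pow,
        le_div_iff₀ hβ]
      have : β * (x.1 j - x.1 i) ^ 4 ≤ 8 * K ^ 4 := by nlinarith [sq_nonneg (x.1 j - x.1 i)]
      calc (K ^ 4)⁻¹ * (x.1 j - x.1 i) ^ 4 * β = β * (x.1 j - x.1 i) ^ 4 / K ^ 4 := by ring
        _ ≤ 8 * K ^ 4 / K ^ 4 := div_le_div_of_nonneg_right this (by positivity)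
        _ = 8 := by field_simp
    have := le_max_one_of_sq_le (sq_nonneg _) h4
    linarith
  have hΦ : (∑ i, ω₂ * (rescale K x).1 i ^ 2 / 2) + ∑ i : Fin N, ∑ j : Fin N,
      (if j.val = i.val + 1 then ((rescale K x).1 j - (rescale K x).1 i) ^ 2 / 2 else 0) ≤
      N * (ω₂ * max 1 (8 / lam) + max 1 (8 / β)) / 2 := by
    have h1 : ∑ i, ω₂ * (rescale K x).1 i ^ 2 / 2 ≤ ∑ _i : Fin N, ω₂ * max 1 (8 / lam) / 2 :=
      Finset.sum_le_sum fun i _ => hq i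
    have h2 : ∑ i : Fin N, ∑ j : Fin N, (if j.val = i.val + 1 then
        ((rescale K x).1 j - (rescale K x).1 i) ^ 2 / 2 else 0) ≤ ∑ _i : Fin N, max 1 (8 / β) / 2 :=
      Finset.sum_le_sum fun i _ => sum_ite_succ_le (g := fun i j => ((rescale K x).1 j - (rescale K x).1 i) ^ 2 / 2)
        (by positivity) i (hb i)
    simp only [Finset.sum_const, Finset.card_univ, Fintype.card_fin, nsmul_eq_mul] at h1 h2
    nlinarith
  have hK2 : 0 < K ^ 2 := by positivity
  have hε : (K ^ 2)⁻¹ * ((∑ i, ω₂ * (rescale K x).1 i ^ 2 / 2) + ∑ i : Fin N, ∑ j : Fin N,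
      (if j.val = i.val + 1 then ((rescale K x).1 j - (rescale K x).1 i) ^ 2 / 2 else 0)) ≤ 1 / 2 := by
    rw [inv_mul_le_iff₀ hK2]
    nlinarith
  linarith

/-! ### The bad event: large running maximum of the Brownian pair on a short window -/

/-- **The bad event is `O(1/K)`** for the threshold `a = √K/c` (`c ≥ 1`) on a window `h ≤ 1` with
`2c²(h+1) ≤ K`: `P((goodEvent a h)ᶜ) ≤ 16c⁴/K` (the `O(h²/a⁴)` bound of `BrownianSupTail.lean`).
[folklore] -/
theorem wienerPair_compl_goodEvent_le {K c : ℝ} (hK : 1 ≤ K) (hc : 1 ≤ c) (h : ℝ≥0) (hh : (h : ℝ) ≤ 1)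
    (hKc : 2 * c ^ 2 * ((h : ℝ) + 1) ≤ K) :
    wienerPair (goodEvent (Real.sqrt K / c) h)ᶜ ≤ ENNReal.ofReal (16 * c ^ 4 / K) := by
  have hK0 : 0 < K := by linarith
  have hc0 : 0 < c := by linarith
  have ha2 : (Real.sqrt K / c) ^ 2 = K / c ^ 2 := by rw [div_pow, Real.sq_sqrt hK0.le]
  have hgap : K / (2 * c ^ 2) ≤ (Real.sqrt K / c) ^ 2 - h := by
    rw [ha2]
    have h1 : (h : ℝ) ≤ K / (2 * c ^ 2) := by
      rw [le_div_iff₀ (by positivity)]; nlinarith [h.coe_nonneg]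
    have h2 : K / c ^ 2 = K / (2 * c ^ 2) + K / (2 * c ^ 2) := by field_simp; ring
    linarith
  have hpos : 0 < (Real.sqrt K / c) ^ 2 - h := lt_of_lt_of_le (by positivity) hgap
  have hlt : (h : ℝ) < (Real.sqrt K / c) ^ 2 := by linarith
  have hb := measure_compl_goodEvent_le (by positivity : 0 ≤ Real.sqrt K / c) h hlt
  refine hb.trans ?_
  have h3 : 2 * (h : ℝ) ^ 2 / ((Real.sqrt K / c) ^ 2 - h) ^ 2 ≤ 8 * c ^ 4 / K := by
    have h4 : (h : ℝ) ^ 2 ≤ 1 := by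
      have := h.coe_nonneg; nlinarith
    have h5 : (K / (2 * c ^ 2)) ^ 2 ≤ ((Real.sqrt K / c) ^ 2 - h) ^ 2 :=
      pow_le_pow_left₀ (by positivity) hgap 2
    calc 2 * (h : ℝ) ^ 2 / ((Real.sqrt K / c) ^ 2 - h) ^ 2 ≤ 2 * 1 / (K / (2 * c ^ 2)) ^ 2 :=
          div_le_div₀ (by norm_num) (by linarith) (by positivity) h5
      _ = 8 * c ^ 4 / K ^ 2 := by field_simp; ring
      _ ≤ 8 * c ^ 4 / K := div_le_div_of_nonneg_left (by positivity) hK0 (by nlinarith)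
  calc 2 * ENNReal.ofReal (2 * (h : ℝ) ^ 2 / ((Real.sqrt K / c) ^ 2 - h) ^ 2)
      ≤ 2 * ENNReal.ofReal (8 * c ^ 4 / K) := by gcongr
    _ = ENNReal.ofReal (16 * c ^ 4 / K) := by
        rw [← ENNReal.ofReal_ofNat 2, ← ENNReal.ofReal_mul (by norm_num)]
        congr 1; ring

/-- **On the good event the noise path is small**: `‖η(s)‖ ≤ (|c_L| + |c_R|) a` for `s ∈ [0, h]`,
`η = chainNoise N c_L c_R (pairPath ω)`, `ω ∈ goodEvent a h`. [folklore] -/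
theorem norm_chainNoise_le_of_mem_goodEvent (c_L c_R : ℝ) {a : ℝ} {h : ℝ≥0} {ω : WienerPair}
    (hω : ω ∈ goodEvent a h) {s : ℝ} (hs : s ≤ h) :
    ‖chainNoise N c_L c_R (pairPath ω) s‖ ≤ (|c_L| + |c_R|) * a := by
  have h1 := norm_chainNoise_pairPath_le (N := N) c_L c_R ω s
  have h2 := abs_brownian_toNNReal_le_of_mem_goodEvent hω hs
  calc ‖chainNoise N c_L c_R (pairPath ω) s‖
      ≤ |c_L| * |brownian s.toNNReal ω.1| + |c_R| * |brownian s.toNNReal ω.2| := h1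
    _ ≤ |c_L| * a + |c_R| * a :=
        add_le_add (mul_le_mul_of_nonneg_left h2.1 (abs_nonneg _)) (mul_le_mul_of_nonneg_left h2.2 (abs_nonneg _))
    _ = (|c_L| + |c_R|) * a := by ring

/-! ### One window: from a pathwise dissipation bound to the decay of `P_w e^{θH}` -/

section Window

variable {ω₂ lam β γ : ℝ} {T_L T_R : ℝ}
variable (hω : 0 < ω₂) (hl : 0 ≤ lam) (hβ : 0 < β) (hγ : 0 < γ) (hN : 0 < N) (hTL : 0 < T_L)
  (hTR : 0 < T_R)
include hω hl hβ hγ hN hTL hTR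

set_option maxHeartbeats 1600000 in
/-- **The decay over one window from a pathwise dissipation bound.** At scale `K` (`H(z) ≤ 2K⁴`),
for a window `w ≤ min(1, t*)` on which every noise path of size `≤ √K` makes the smooth part
dissipate at least `Dis`, with the energy error of `LangevinChainEnergyScale.lean` at most `Dis/2`,
`θ Dis/2 ≥ log(2/κ₀)`, and `K` so large that the bad event `{sup |B| > √K/c}` is negligible:
`P_w e^{θH}(z) ≤ κ₀ e^{θH(z)}`. The good event is handled by
`pinnedChain_window_decay_of_pathwise` (`LangevinChainH2.lean`), the bad one by Hölder, (3.4) and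
`BrownianSupTail.lean`. [cite: CuneoEckmannHairerReyBellet2018, Thm 5.1 (proof, p. 12)] -/
theorem pinnedChain_window_decay_of_dissipation {θ : ℝ} (hθ : 0 < θ) {p : ℝ} (hp : 1 < p)
    (hpθ : p * θ < 1 / max T_L T_R) (tstar : ℝ≥0) {K wr Dis κ₀ : ℝ} (hK : 1 ≤ K) (hwr0 : 0 < wr)
    (hwr1 : wr ≤ 1) (hwrt : wr ≤ tstar) (hκ₀ : 0 < κ₀) {z : PhaseSpace N}
    (hz2 : (pinnedChain ω₂ lam β γ).hamiltonian N z ≤ 2 * K ^ 4)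
    (hAM : pinnedChainScaleA γ N * Real.sqrt K * wr ≤ K)
    (hdis : ∀ η : ℝ → Fin N → ℝ, Continuous η → (∀ s ∈ Icc 0 wr, ‖η s‖ ≤ Real.sqrt K) →
      Dis ≤ γ * ∫ s in (0 : ℝ)..wr, ∑ i, bathWeight N i *
        ((pinnedChain ω₂ lam β γ).chainFlow N z η s - ((0 : Fin N → ℝ), η s)).2 i ^ 2)
    (herr : wr * Real.sqrt K * ((pinnedChainScaleA γ N * pinnedChainScaleC ω₂ lam β γ N +
        pinnedChainScaleB ω₂ lam β γ N) * K ^ 3) +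
        N * Real.sqrt K * ((pinnedChainScaleC ω₂ lam β γ N + 1 / 2) * K ^ 2 + Real.sqrt K / 2) ≤ Dis / 2)
    (hD : Real.log (2 / κ₀) ≤ θ * Dis / 2)
    (hcs : 4 * (|Real.sqrt (2 * γ * T_L)| + |Real.sqrt (2 * γ * T_R)| + 1) ^ 2 ≤ K)
    (hbad : 16 * (|Real.sqrt (2 * γ * T_L)| + |Real.sqrt (2 * γ * T_R)| + 1) ^ 4 / K ≤
      (κ₀ / (2 * Real.exp (θ * γ * (T_L + T_R) * tstar))) ^ (1 - p⁻¹)⁻¹) :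
    ∃ w : ℝ≥0, w ≤ tstar ∧
      ∫⁻ y, ENNReal.ofReal (Real.exp (θ * (pinnedChain ω₂ lam β γ).hamiltonian N y))
          ∂((pinnedChain ω₂ lam β γ).transitionKernel N T_L T_R w z) ≤
        ENNReal.ofReal (κ₀ * Real.exp (θ * (pinnedChain ω₂ lam β γ).hamiltonian N z)) := by
  set P := pinnedChain ω₂ lam β γ with hP
  set H := P.hamiltonian N with hH
  set A := pinnedChainScaleA γ N with hA
  set c₁ := pinnedChainScaleC ω₂ lam β γ N with hc₁
  set B := pinnedChainScaleB ω₂ lam β γ N with hB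
  set c_L := Real.sqrt (2 * γ * T_L) with hcL
  set c_R := Real.sqrt (2 * γ * T_R) with hcR
  set cs := |c_L| + |c_R| + 1 with hcs'
  have hcs1 : 1 ≤ cs := by rw [hcs']; linarith [abs_nonneg c_L, abs_nonneg c_R]
  have hcs0 : 0 < cs := by linarith
  have hK0 : 0 < K := by linarith
  set M := Real.sqrt K with hM
  have hM1 : 1 ≤ M := by rw [hM, Real.le_sqrt (by norm_num) hK0.le]; simpa using hK
  have hM0 : 0 < M := by linarith
  have hMK : M ^ 2 = K := Real.sq_sqrt hK0.le
  set w : ℝ≥0 := ⟨wr, hwr0.le⟩ with hw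
  have hwc : ((w : ℝ≥0) : ℝ) = wr := rfl
  set a := M / cs with ha
  set C := θ * γ * (T_L + T_R) with hC
  have hC0 : 0 ≤ C := by rw [hC]; have := hTL.le; have := hTR.le; positivity
  set G := Real.exp (C * tstar) with hG
  set D := θ * Dis / 2 with hDdef
  refine ⟨w, by exact_mod_cast hwrt, ?_⟩
  -- the pathwise energy drop on the good event
  have hgood : ∀ ω ∈ goodEvent a w,
      θ * H (P.solMap N T_L T_R w z (pairPath ω)) ≤ θ * H z - D := by
    intro ω hω'
    set η := chainNoise N (Real.sqrt (2 * P.γ * T_L)) (Real.sqrt (2 * P.γ * T_R)) (pairPath ω) with hη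
    have hηc : Continuous η := continuous_chainNoise _ _ _
    have hsol : P.solMap N T_L T_R w z (pairPath ω) = P.chainFlow N z η wr := rfl
    have hMb : ∀ s ∈ Icc 0 wr, ‖η s‖ ≤ M := by
      intro s hs
      have h1 := norm_chainNoise_le_of_mem_goodEvent (N := N) (Real.sqrt (2 * P.γ * T_L))
        (Real.sqrt (2 * P.γ * T_R)) hω' (s := s) (by rw [hwc]; exact hs.2)
      have hγ' : P.γ = γ := rfl
      rw [hγ'] at h1
      refine h1.trans ?_
      rw [ha, ← hcL, ← hcR]
      rw [mul_div_assoc']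
      rw [div_le_iff₀ hcs0]
      nlinarith [abs_nonneg c_L, abs_nonneg c_R, hM0.le]
    have hAMT : A * M * wr ≤ K := hAM
    have hdrop := pinnedChain_hamiltonian_chainFlow_le_sub_dissipation hω hl hβ.le hγ.le N hK z hz2 hηc
      (T := wr) (M := M) hMb hAMT (t := wr) ⟨hwr0.le, le_rfl⟩
    have hdiss := hdis η hηc hMb
    rw [hsol]
    have hdrop' : H (P.chainFlow N z η wr) ≤ H z - γ * (∫ s in (0 : ℝ)..wr, ∑ i, bathWeight N i *
        (P.chainFlow N z η s - ((0 : Fin N → ℝ), η s)).2 i ^ 2) +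
        wr * M * ((A * c₁ + B) * K ^ 3) + N * M * ((c₁ + 1 / 2) * K ^ 2 + M / 2) := hdrop
    have : H (P.chainFlow N z η wr) ≤ H z - Dis / 2 := by linarith
    rw [hDdef]
    nlinarith [hθ]
  -- the probabilistic shell
  have hP3 := pinnedChain_window_decay_of_pathwise hω hl hβ hγ hN hTL hTR hθ hp hpθ w a D z hgood
  refine hP3.trans ?_
  -- the three factors
  have hr0 : 0 < 1 - p⁻¹ := by
    have : p⁻¹ < 1 := inv_lt_one_of_one_lt₀ hp
    linarith
  have h1 : Real.exp (-D) ≤ κ₀ / 2 := by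
    have hD' : Real.log (2 / κ₀) ≤ D := by rw [hDdef]; linarith
    have := Real.exp_le_exp.2 (neg_le_neg hD')
    rw [Real.exp_neg (Real.log (2 / κ₀)), Real.exp_log (by positivity), inv_div] at this
    exact this
  have h2 : Real.exp (θ * γ * (T_L + T_R) * w) ≤ G := by
    rw [hG, hC]; refine Real.exp_le_exp.2 ?_
    rw [hwc]
    exact mul_le_mul_of_nonneg_left (by exact_mod_cast hwrt) hC0
  set y₀ := κ₀ / (2 * G) with hy₀
  have hy₀0 : 0 < y₀ := by positivity
  have hGpos : 0 < G := by rw [hG]; exact Real.exp_pos _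
  have hGy : G * y₀ = κ₀ / 2 := by
    rw [hy₀]; field_simp
  have h3 : (wienerPair (goodEvent a w)ᶜ) ^ (1 - p⁻¹) ≤ ENNReal.ofReal y₀ := by
    have hb := wienerPair_compl_goodEvent_le hK hcs1 w (by rw [hwc]; exact hwr1)
      (by rw [hwc]; nlinarith [sq_nonneg cs])
    have hb' : (wienerPair (goodEvent a w)ᶜ) ^ (1 - p⁻¹) ≤ (ENNReal.ofReal (16 * cs ^ 4 / K)) ^ (1 - p⁻¹) :=
      ENNReal.rpow_le_rpow hb hr0.le
    refine hb'.trans ?_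
    rw [ENNReal.ofReal_rpow_of_nonneg (by positivity) hr0.le]
    refine ENNReal.ofReal_le_ofReal ?_
    have hx : 16 * cs ^ 4 / K ≤ y₀ ^ (1 - p⁻¹)⁻¹ := hbad
    calc (16 * cs ^ 4 / K) ^ (1 - p⁻¹) ≤ (y₀ ^ (1 - p⁻¹)⁻¹) ^ (1 - p⁻¹) :=
          Real.rpow_le_rpow (by positivity) hx hr0.le
      _ = y₀ := Real.rpow_inv_rpow hy₀0.le hr0.ne'
  calc ENNReal.ofReal (Real.exp (θ * H z)) * (ENNReal.ofReal (Real.exp (-D)) +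
        ENNReal.ofReal (Real.exp (θ * γ * (T_L + T_R) * w)) * (wienerPair (goodEvent a w)ᶜ) ^ (1 - p⁻¹))
      ≤ ENNReal.ofReal (Real.exp (θ * H z)) * (ENNReal.ofReal (κ₀ / 2) + ENNReal.ofReal G * ENNReal.ofReal y₀) := by
        have h1' := ENNReal.ofReal_le_ofReal h1
        have h2' := ENNReal.ofReal_le_ofReal h2
        gcongr
    _ = ENNReal.ofReal (κ₀ * Real.exp (θ * H z)) := by
        rw [← ENNReal.ofReal_mul hGpos.le, ← ENNReal.ofReal_add (by positivity) (by positivity),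
          ← ENNReal.ofReal_mul (Real.exp_pos _).le, hGy]
        congr 1
        ring

end Window

/-! ### The discharge of the named fact -/

set_option maxHeartbeats 3200000 in
/-- **Cuneo–Eckmann–Hairer–Rey-Bellet 2018, Theorem 5.1 with Remark 5.2 (the Lyapunov condition H2
for `V = e^{θH}`) for the transition semigroup of the pinned chain — the named fact
`CuneoEckmannHairerReyBellet2018_H2` of `LangevinChainDynkin.lean`, PROVED** for all `ω₂, β, γ > 0`,
`lam ≥ 0`, `N ≥ 1`, `T_L, T_R > 0`, `0 < θ < 1/max(T_L,T_R)`, `t* > 0`. Printed: "We fix `t_* > 0` and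
`θ < 1/T_max` … Theorem 5.1. Under Conditions C1, C3, C4 and C5, there is a constant `C₁ > 0` such
that for all `z₀` such that `H(z₀)` is large enough, `E_{z₀} e^{θH(z_{t*}) - θH(z₀)} ≤ e^{-C₁H(z₀)}`.
Remark 5.2. By the coercivity of `H`, the theorem above implies that there exist constants
`κ ∈ (0,1)` and `c > 0`, and a compact set `K` such that `E_z e^{θH(z_{t*})} ≤ κ e^{θH(z)} + c1_K(z)`."
The proof assembles the tree's Itô-free route: at energy `E = K⁴` the dissipation of the smooth
part over the window `1/K` (interaction regime, `LangevinChainScaleCloseness.lean`; automatic for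
`lam > 0`, `limitChain_hamiltonian_ge_half_of_pos`) or over a window of order one (pinning regime,
`lam = 0`, `LangevinChainCentreOfMass.lean`) beats the energy error of a noise path of size `√K`
(`LangevinChainEnergyScale.lean`), the bad event `{sup|B| > √K/c}` is `O(1/K)` (`BrownianSupTail.lean`)
and is absorbed by Hölder and (3.4) (`LangevinChainH2.lean`), so `P_w e^{θH}(z) ≤ κ₀ e^{θH(z)}` for
`H(z)` large, whence Remark 5.2's form by Chapman–Kolmogorov, (3.4) and the compact sublevel sets of
`H` (the weaker decay `E e^{θH(z_{t*})-θH(z₀)} → 0` of Carmona 2007, Remark 5.7, in place of (5.1)).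
[cite: CuneoEckmannHairerReyBellet2018, Thm 5.1 and Rem 5.2] -/
theorem CuneoEckmannHairerReyBellet2018_H2_holds : CuneoEckmannHairerReyBellet2018_H2 := by
  intro ω₂ lam β γ hω hl hβ hγ N T_L T_R hN hTL hTR θ hθ hθ' tstar htstar
  -- the Hölder exponent `p` with `1 < p`, `pθ < 1/max(T_L,T_R)`
  have hTmax : 0 < max T_L T_R := lt_max_of_lt_left hTL
  have hθT0 : 0 < θ * max T_L T_R := mul_pos hθ hTmax
  have hθT : θ * max T_L T_R < 1 := by rwa [lt_div_iff₀ hTmax] at hθ'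
  obtain ⟨p, hpdef⟩ : ∃ p : ℝ, p = (1 / (θ * max T_L T_R) + 1) / 2 := ⟨_, rfl⟩
  have hp1 : 1 < p := by
    have h1 : 1 < 1 / (θ * max T_L T_R) := by rw [lt_div_iff₀ hθT0]; linarith only [hθT]
    rw [hpdef]; linarith only [h1]
  have hpθ : p * θ < 1 / max T_L T_R := by
    rw [hpdef, lt_div_iff₀ hTmax]
    have e : (1 / (θ * max T_L T_R) + 1) / 2 * θ * max T_L T_R = (1 + θ * max T_L T_R) / 2 := by
      field_simp
    rw [e]; linarith only [hθT]
  have hr0 : 0 < 1 - p⁻¹ := by have := inv_lt_one_of_one_lt₀ hp1; linarith only [this]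
  -- the constants of the energy estimates
  set A := pinnedChainScaleA γ N with hA
  have hA1 : 1 ≤ A := one_le_pinnedChainScaleA hγ.le N
  set c₁ := pinnedChainScaleC ω₂ lam β γ N with hc₁
  set B := pinnedChainScaleB ω₂ lam β γ N with hB
  have hc₁0 : 0 ≤ c₁ := pinnedChainScaleC_nonneg hω.le hl hβ.le hγ.le N
  have hB0 : 0 ≤ B := pinnedChainScaleB_nonneg hω.le hl hβ.le hγ.le N
  obtain ⟨CI, hCI⟩ : ∃ CI : ℝ, CI = (A * c₁ + B) + N * (c₁ + 1 / 2) + N / 2 := ⟨_, rfl⟩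
  have hCI0 : 0 ≤ CI := by rw [hCI]; positivity
  obtain ⟨cs, hcs⟩ : ∃ cs : ℝ, cs = |Real.sqrt (2 * γ * T_L)| + |Real.sqrt (2 * γ * T_R)| + 1 := ⟨_, rfl⟩
  have hcs1 : 1 ≤ cs := by
    rw [hcs]; linarith only [abs_nonneg (Real.sqrt (2 * γ * T_L)), abs_nonneg (Real.sqrt (2 * γ * T_R))]
  -- the decay factor `κ₀` and the thresholds it induces
  obtain ⟨G, hG⟩ : ∃ G : ℝ, G = Real.exp (θ * γ * (T_L + T_R) * tstar) := ⟨_, rfl⟩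
  have hG1 : 1 ≤ G := by
    rw [hG]; apply Real.one_le_exp
    have := hTL.le; have := hTR.le; positivity
  obtain ⟨κ₀, hκ₀⟩ : ∃ κ₀ : ℝ, κ₀ = 1 / (2 * G) := ⟨_, rfl⟩
  have hκ₀0 : 0 < κ₀ := by rw [hκ₀]; positivity
  have hκ₀1 : κ₀ ≤ 1 / 2 := by
    rw [hκ₀, div_le_div_iff₀ (by positivity) (by norm_num)]; linarith only [hG1]
  have hκG : κ₀ * Real.exp (θ * γ * (T_L + T_R) * tstar) ≤ 1 / 2 := by
    rw [← hG, hκ₀]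
    have hG0 : G ≠ 0 := by linarith only [hG1]
    have e : 1 / (2 * G) * G = 1 / 2 := by field_simp
    rw [e]
  obtain ⟨L₀, hL₀⟩ : ∃ L₀ : ℝ, L₀ = Real.log (2 / κ₀) := ⟨_, rfl⟩
  have hL₀0 : 0 ≤ L₀ := by
    rw [hL₀]; apply Real.log_nonneg; rw [le_div_iff₀ hκ₀0]; linarith only [hκ₀1]
  obtain ⟨y₀, hy₀⟩ : ∃ y₀ : ℝ, y₀ = κ₀ / (2 * G) := ⟨_, rfl⟩
  have hy₀0 : 0 < y₀ := by rw [hy₀]; positivity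
  obtain ⟨x₀, hx₀⟩ : ∃ x₀ : ℝ, x₀ = y₀ ^ (1 - p⁻¹)⁻¹ := ⟨_, rfl⟩
  have hx₀0 : 0 < x₀ := by rw [hx₀]; exact Real.rpow_pos_of_pos hy₀0 _
  -- the noise size `δ₀` of the dissipation lemmas and the pinning window
  obtain ⟨δ₀, hδ₀⟩ : ∃ δ₀ : ℝ, δ₀ = 1 / (A + 1) := ⟨_, rfl⟩
  have hδ₀0 : 0 < δ₀ := by rw [hδ₀]; positivity
  have hδ₀1 : δ₀ ≤ 1 := by rw [hδ₀, div_le_one (by positivity)]; linarith only [hA1]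
  have hAδ : A * δ₀ * 1 ≤ 1 := by
    rw [hδ₀, mul_one, mul_one_div, div_le_one (by positivity)]; linarith only [hA1]
  obtain ⟨T₂, hT₂⟩ : ∃ T₂ : ℝ, T₂ = min (tstar : ℝ) 1 := ⟨_, rfl⟩
  have hT₂0 : 0 < T₂ := by rw [hT₂]; exact lt_min (by exact_mod_cast htstar) one_pos
  have hT₂1 : T₂ ≤ 1 := by rw [hT₂]; exact min_le_right _ _
  have hT₂t : T₂ ≤ tstar := by rw [hT₂]; exact min_le_left _ _
  have hAδ₂ : A * δ₀ * T₂ ≤ 1 := (mul_le_mul_of_nonneg_left hT₂1 (by positivity)).trans hAδ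
  -- the two dissipation packages (interaction regime; pinning regime for `lam = 0`)
  obtain ⟨KI, εI, hKI1, hεI, hI⟩ := pinnedChain_dissipation_ge_interaction (ω₂ := ω₂) (lam := lam) (β := β)
    (γ := γ) hω hl hβ hγ hN (Λ := 1) one_pos hδ₀0 hδ₀1 hAδ
  obtain ⟨KII, εII, hKII1, hεII, hII⟩ := pinnedChain_dissipation_ge_pinning (ω₂ := ω₂) (β := β) (γ := γ)
    hω hβ hγ hN hT₂0 hδ₀0 hδ₀1 hAδ₂
  obtain ⟨CΦ, hCΦ⟩ : ∃ CΦ : ℝ, CΦ = N * (ω₂ * max 1 (8 / lam) + max 1 (8 / β)) / 2 := ⟨_, rfl⟩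
  have hCΦ0 : 0 ≤ CΦ := by rw [hCΦ]; positivity
  -- the scale threshold `K₅` and the energy threshold `E₁ = K₅⁴`
  obtain ⟨K₅, hK₅⟩ : ∃ K₅ : ℝ, K₅ = 1 + KI + KII + (2 * CΦ + 1) + (A + 1) ^ 2 + 1 / (tstar : ℝ) +
      4 * cs ^ 2 + (2 * CI / εI) ^ 2 + (2 * CI / εII) ^ 2 + 16 * cs ^ 4 / x₀ + 2 * L₀ / (θ * εI) +
      2 * L₀ / (θ * εII) := ⟨_, rfl⟩
  have hts0 : (0 : ℝ) < tstar := by exact_mod_cast htstar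
  have hs1 : 0 ≤ KI := by linarith only [hKI1]
  have hs2 : 0 ≤ KII := by linarith only [hKII1]
  have hs3 : 0 ≤ 2 * CΦ + 1 := by positivity
  have hs4 : 0 ≤ (A + 1) ^ 2 := by positivity
  have hs5 : 0 ≤ 1 / (tstar : ℝ) := by positivity
  have hs6 : 0 ≤ 4 * cs ^ 2 := by positivity
  have hs7 : 0 ≤ (2 * CI / εI) ^ 2 := by positivity
  have hs8 : 0 ≤ (2 * CI / εII) ^ 2 := by positivity
  have hs9 : 0 ≤ 16 * cs ^ 4 / x₀ := by positivity
  have hs10 : 0 ≤ 2 * L₀ / (θ * εI) := by positivity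
  have hs11 : 0 ≤ 2 * L₀ / (θ * εII) := by positivity
  obtain ⟨E₁, hE₁⟩ : ∃ E₁ : ℝ, E₁ = K₅ ^ 4 := ⟨_, rfl⟩
  refine pinnedChain_H2_of_decay hω hl hβ hγ hN hTL hTR hθ hθ' tstar (E₁ := E₁)
    (pinnedChain_decay_of_window hω hl hβ hγ hN hTL hTR hθ hθ' tstar (E₁ := E₁) (κ₀ := κ₀) hκG ?_)
  intro z hz
  -- the scale of `z`: `K = H(z)^{1/4} ≥ K₅`
  have hHz0 : 0 ≤ (pinnedChain ω₂ lam β γ).hamiltonian N z := pinnedChain_hamiltonian_nonneg hω.le hl hβ.le γ N z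
  obtain ⟨K, hKdef⟩ : ∃ K : ℝ, K = Real.sqrt (Real.sqrt ((pinnedChain ω₂ lam β γ).hamiltonian N z)) := ⟨_, rfl⟩
  have hK4 : K ^ 4 = (pinnedChain ω₂ lam β γ).hamiltonian N z := by
    rw [hKdef, show (4 : ℕ) = 2 * 2 from rfl, pow_mul, Real.sq_sqrt (Real.sqrt_nonneg _), Real.sq_sqrt hHz0]
  have hK₅1 : 1 ≤ K₅ := by rw [hK₅]; linarith only [hs1, hs2, hs3, hs4, hs5, hs6, hs7, hs8, hs9, hs10, hs11]
  have hK5 : K₅ ≤ K := by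
    rw [hKdef, Real.le_sqrt (by linarith only [hK₅1]) (Real.sqrt_nonneg _), Real.le_sqrt (by positivity) hHz0]
    calc (K₅ ^ 2) ^ 2 = E₁ := by rw [hE₁]; ring
      _ ≤ _ := hz
  have hthr : ∀ x : ℝ, x ≤ K₅ → x ≤ K := fun x hx => hx.trans hK5
  have hK1 : 1 ≤ K := hthr 1 (by rw [hK₅]; linarith only [hs1, hs2, hs3, hs4, hs5, hs6, hs7, hs8, hs9, hs10, hs11])
  have hK0 : 0 < K := by linarith only [hK1]
  have hKI : KI ≤ K := hthr _ (by rw [hK₅]; linarith only [hs1, hs2, hs3, hs4, hs5, hs6, hs7, hs8, hs9, hs10, hs11])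
  have hKII : KII ≤ K := hthr _ (by rw [hK₅]; linarith only [hs1, hs2, hs3, hs4, hs5, hs6, hs7, hs8, hs9, hs10, hs11])
  have hKΦ' : 2 * CΦ + 1 ≤ K := hthr _ (by rw [hK₅]; linarith only [hs1, hs2, hs3, hs4, hs5, hs6, hs7, hs8, hs9, hs10, hs11])
  have hKA2 : (A + 1) ^ 2 ≤ K := hthr _ (by rw [hK₅]; linarith only [hs1, hs2, hs3, hs4, hs5, hs6, hs7, hs8, hs9, hs10, hs11])
  have hKt : 1 / (tstar : ℝ) ≤ K := hthr _ (by rw [hK₅]; linarith only [hs1, hs2, hs3, hs4, hs5, hs6, hs7, hs8, hs9, hs10, hs11])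
  have hKcs : 4 * cs ^ 2 ≤ K := hthr _ (by rw [hK₅]; linarith only [hs1, hs2, hs3, hs4, hs5, hs6, hs7, hs8, hs9, hs10, hs11])
  have hKeI : (2 * CI / εI) ^ 2 ≤ K := hthr _ (by rw [hK₅]; linarith only [hs1, hs2, hs3, hs4, hs5, hs6, hs7, hs8, hs9, hs10, hs11])
  have hKeII : (2 * CI / εII) ^ 2 ≤ K := hthr _ (by rw [hK₅]; linarith only [hs1, hs2, hs3, hs4, hs5, hs6, hs7, hs8, hs9, hs10, hs11])
  have hKx : 16 * cs ^ 4 / x₀ ≤ K := hthr _ (by rw [hK₅]; linarith only [hs1, hs2, hs3, hs4, hs5, hs6, hs7, hs8, hs9, hs10, hs11])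
  have hKLI : 2 * L₀ / (θ * εI) ≤ K := hthr _ (by rw [hK₅]; linarith only [hs1, hs2, hs3, hs4, hs5, hs6, hs7, hs8, hs9, hs10, hs11])
  have hKLII : 2 * L₀ / (θ * εII) ≤ K := hthr _ (by rw [hK₅]; linarith only [hs1, hs2, hs3, hs4, hs5, hs6, hs7, hs8, hs9, hs10, hs11])
  have hz1 : K ^ 4 ≤ (pinnedChain ω₂ lam β γ).hamiltonian N z := hK4.le
  have hz2 : (pinnedChain ω₂ lam β γ).hamiltonian N z ≤ 2 * K ^ 4 := by rw [← hK4]; linarith only [pow_nonneg hHz0 1, sq_nonneg (K ^ 2)]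
  -- `M = √K`
  obtain ⟨M, hM⟩ : ∃ M : ℝ, M = Real.sqrt K := ⟨_, rfl⟩
  have hMK : M * M = K := by rw [hM]; exact Real.mul_self_sqrt hK0.le
  have hM1 : 1 ≤ M := by rw [hM, Real.le_sqrt (by norm_num) hK0.le]; simpa using hK1
  have hM0 : 0 < M := by linarith only [hM1]
  have hAM' : A + 1 ≤ M := by rw [hM, Real.le_sqrt (by positivity) hK0.le]; exact hKA2
  have hMδ : M ≤ δ₀ * K := by
    rw [hδ₀, one_div, le_inv_mul_iff₀ (by positivity : 0 < A + 1)]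
    calc (A + 1) * M ≤ M * M := mul_le_mul_of_nonneg_right hAM' hM0.le
      _ = K := hMK
  have hAM : A * M ≤ K := by
    calc A * M ≤ M * M := mul_le_mul_of_nonneg_right (by linarith only [hAM']) hM0.le
      _ = K := hMK
  have hbadK : 16 * cs ^ 4 / K ≤ x₀ := by
    rw [div_le_iff₀ hK0]
    have := hKx
    rw [div_le_iff₀ hx₀0] at this
    linarith only [this]
  have hKcs' : 4 * (|Real.sqrt (2 * γ * T_L)| + |Real.sqrt (2 * γ * T_R)| + 1) ^ 2 ≤ K := by
    rw [← hcs]; exact hKcs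
  have hbadK' : 16 * (|Real.sqrt (2 * γ * T_L)| + |Real.sqrt (2 * γ * T_R)| + 1) ^ 4 / K ≤
      (κ₀ / (2 * Real.exp (θ * γ * (T_L + T_R) * tstar))) ^ (1 - p⁻¹)⁻¹ := by
    rw [← hcs, ← hG, ← hy₀, ← hx₀]; exact hbadK
  have hMeI : 2 * CI ≤ εI * M := by
    have h1 : 2 * CI / εI ≤ M := by rw [hM, Real.le_sqrt (by positivity) hK0.le]; exact hKeI
    rw [div_le_iff₀ hεI] at h1
    linarith only [h1]
  have hMeII : 2 * CI ≤ εII * M := by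
    have h1 : 2 * CI / εII ≤ M := by rw [hM, Real.le_sqrt (by positivity) hK0.le]; exact hKeII
    rw [div_le_iff₀ hεII] at h1
    linarith only [h1]
  have hK2 : K ≤ K ^ 2 := by nlinarith only [hK1]
  have hK3 : K ^ 2 ≤ K ^ 3 := by nlinarith only [hK1, hK2]
  have hKMK : K ≤ M * K ^ 2 := by nlinarith only [hM1, hK2, hK0]
  -- the interaction-regime window (used for `lam > 0`, and for `lam = 0` when `Ĥ ≥ 1/2`)
  have hwinI : 1 / 2 ≤ (limitChain lam β).hamiltonian N (rescale K z) →
      ∃ w : ℝ≥0, w ≤ tstar ∧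
        ∫⁻ y, ENNReal.ofReal (Real.exp (θ * (pinnedChain ω₂ lam β γ).hamiltonian N y))
            ∂((pinnedChain ω₂ lam β γ).transitionKernel N T_L T_R w z) ≤
          ENNReal.ofReal (κ₀ * Real.exp (θ * (pinnedChain ω₂ lam β γ).hamiltonian N z)) := by
    intro hreg
    have hwt : 1 / K ≤ (tstar : ℝ) := by rw [one_div_le hK0 hts0]; exact hKt
    refine pinnedChain_window_decay_of_dissipation hω hl hβ hγ hN hTL hTR hθ hp1 hpθ tstar (K := K)
      (wr := 1 / K) (Dis := εI * K ^ 3) (κ₀ := κ₀) hK1 (by positivity)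
      (by rw [div_le_one hK0]; exact hK1) hwt hκ₀0 hz2 ?_ ?_ ?_ ?_ hKcs' hbadK'
    · -- `A √K (1/K) ≤ K`
      rw [← hA, ← hM]
      calc A * M * (1 / K) ≤ A * M * 1 := by
            refine mul_le_mul_of_nonneg_left ?_ (by positivity)
            rw [div_le_one hK0]; exact hK1
        _ ≤ K := by rw [mul_one]; exact hAM
    · intro η hη hηb
      exact hI K hKI z hz2 hreg η hη fun s hs => (hηb s hs).trans (by rw [← hM]; exact hMδ)
    · -- the energy error over the window `1/K` is `≤ CI √K K² ≤ εI K³/2`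
      rw [← hA, ← hc₁, ← hB, ← hM]
      have e1 : 1 / K * M * ((A * c₁ + B) * K ^ 3) = M * (A * c₁ + B) * K ^ 2 := by
        field_simp
      have e2 : N * M * ((c₁ + 1 / 2) * K ^ 2 + M / 2) = N * M * (c₁ + 1 / 2) * K ^ 2 + N * K / 2 := by
        rw [mul_add, show (N : ℝ) * M * (M / 2) = N * (M * M) / 2 by ring, hMK]; ring
      rw [e1, e2]
      have h3 : N * K / 2 ≤ N / 2 * M * K ^ 2 := by
        have := mul_le_mul_of_nonneg_left hKMK (by positivity : (0 : ℝ) ≤ N / 2)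
        linarith only [this]
      have h4 : M * (A * c₁ + B) * K ^ 2 + N * M * (c₁ + 1 / 2) * K ^ 2 + N / 2 * M * K ^ 2 = CI * M * K ^ 2 := by
        rw [hCI]; ring
      have h5 : CI * M * K ^ 2 ≤ εI * K ^ 3 / 2 := by
        have h6 : CI * M ≤ εI * (M * M) / 2 := by nlinarith only [hMeI, hM0]
        rw [hMK] at h6
        have h7 := mul_le_mul_of_nonneg_right h6 (sq_nonneg K)
        have e : εI * K / 2 * K ^ 2 = εI * K ^ 3 / 2 := by ring
        linarith only [h7, e]
      linarith only [h3, h4, h5]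
    · -- `log(2/κ₀) ≤ θ εI K³/2`
      have h1 : 2 * L₀ ≤ θ * εI * K := by
        have := hKLI
        rw [div_le_iff₀ (by positivity)] at this
        linarith only [this]
      have h2 : K ≤ K ^ 3 := hK2.trans hK3
      have h3 := mul_le_mul_of_nonneg_left h2 (by positivity : 0 ≤ θ * εI)
      rw [← hL₀]
      linarith only [h1, h3]
  rcases hl.eq_or_lt with hl0 | hlpos
  · -- harmonic pinning `lam = 0`: interaction or pinning regime
    subst hl0
    by_cases hreg : 1 / 2 ≤ (limitChain 0 β).hamiltonian N (rescale K z)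
    · exact hwinI hreg
    · push Not at hreg
      refine pinnedChain_window_decay_of_dissipation hω le_rfl hβ hγ hN hTL hTR hθ hp1 hpθ tstar (K := K)
        (wr := T₂) (Dis := εII * K ^ 4) (κ₀ := κ₀) hK1 hT₂0 hT₂1 hT₂t hκ₀0 hz2 ?_ ?_ ?_ ?_ hKcs' hbadK'
      · rw [← hA, ← hM]
        calc A * M * T₂ ≤ A * M * 1 := mul_le_mul_of_nonneg_left hT₂1 (by positivity)
          _ ≤ K := by rw [mul_one]; exact hAM
      · intro η hη hηb
        exact hII K hKII z hz1 hz2 hreg η hη fun s hs => (hηb s hs).trans (by rw [← hM]; exact hMδ)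
      · rw [← hA, ← hc₁, ← hB, ← hM]
        have e2 : N * M * ((c₁ + 1 / 2) * K ^ 2 + M / 2) = N * M * (c₁ + 1 / 2) * K ^ 2 + N * K / 2 := by
          rw [mul_add, show (N : ℝ) * M * (M / 2) = N * (M * M) / 2 by ring, hMK]; ring
        rw [e2]
        have h1 : T₂ * M * ((A * c₁ + B) * K ^ 3) ≤ M * (A * c₁ + B) * K ^ 3 := by
          have := mul_le_mul_of_nonneg_right hT₂1 (by positivity : 0 ≤ M * ((A * c₁ + B) * K ^ 3))
          linarith only [this]
        have h2 : N * M * (c₁ + 1 / 2) * K ^ 2 ≤ N * M * (c₁ + 1 / 2) * K ^ 3 :=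
          mul_le_mul_of_nonneg_left hK3 (by positivity)
        have h3 : N * K / 2 ≤ N / 2 * M * K ^ 3 := by
          have := mul_le_mul_of_nonneg_left (hKMK.trans (mul_le_mul_of_nonneg_left hK3 hM0.le))
            (by positivity : (0 : ℝ) ≤ N / 2)
          linarith only [this]
        have h4 : M * (A * c₁ + B) * K ^ 3 + N * M * (c₁ + 1 / 2) * K ^ 3 + N / 2 * M * K ^ 3 = CI * M * K ^ 3 := by
          rw [hCI]; ring
        have h5 : CI * M * K ^ 3 ≤ εII * K ^ 4 / 2 := by
          have h6 : CI * M ≤ εII * (M * M) / 2 := by nlinarith only [hMeII, hM0]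
          rw [hMK] at h6
          have h7 := mul_le_mul_of_nonneg_right h6 (pow_nonneg hK0.le 3)
          have e : εII * K / 2 * K ^ 3 = εII * K ^ 4 / 2 := by ring
          linarith only [h7, e]
        linarith only [h1, h2, h3, h4, h5]
      · have h1 : 2 * L₀ ≤ θ * εII * K := by
          have := hKLII
          rw [div_le_iff₀ (by positivity)] at this
          linarith only [this]
        have h2 : K ≤ K ^ 4 := (hK2.trans hK3).trans (by nlinarith only [hK1, hK3])
        have h3 := mul_le_mul_of_nonneg_left h2 (by positivity : 0 ≤ θ * εII)
        rw [← hL₀]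
        linarith only [h1, h3]
  · -- quartic pinning `lam > 0`: always the interaction regime
    refine hwinI (limitChain_hamiltonian_ge_half_of_pos hω hlpos hβ hK1 ?_ hz1 hz2)
    rw [← hCΦ]
    linarith only [hKΦ', hK2]

end Literature.MathematicalPhysics.KineticTheory.HeatConduction
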